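import Mathlib
import Summits.NavierStokesRegularity.NavierStokesRegularity.Theses.SubcriticalEnvelope
import Literature.Analysis.FluidPDE.Tao2016AveragedNS.ViscousEnvelopeSmoothing
import HarnessLib

/-!
# `SubcriticalEnvelope.EnvelopeSmoothing` (stmt-NavierStokesRegularity-24008) — the crux in its
# VISCOUS-FAMILY, SUB-WINDOW-UNIFORM form, proved

The item as filed takes, as hypothesis, a subcritical tail-energy envelope over ALL
`(K₁,0)`-pseudo-solutions of the table with window-wise constants `∀ T ∃ C`.  Two defects (evidence
memo `GATED-FRONTS-23973.md` on the item): (i) that class contains every sub-dissipatively STEERED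
trajectory, and gated steering realises exactly critical fronts (so the hypothesis is unsatisfiable at
cascading data — the implication is vacuous there; see the negative lemma
`SubcriticalEnvelopeSubcriticalTailEnvelopeNegative.envelopeSmoothing_hypothesis_false_of_criticalFronts`);
(ii) `∀ T ∃ C` does not feed the continuation step of the intended Barbato–Morandin–Romito §3.2
bootstrap (only windows `[0,T']`, `T' < T*`, are available for the maximal viscous solution, and the
constants `C(T')` need not stay bounded).  The statement the bootstrap DOES prove — and which the glue
`StallOfEnvelope` would consume verbatim from a correspondingly repaired crux A — is the one below:
hypothesis = the subcritical envelope for the regular solutions of the `ν`-VISCOUS lattice itself on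
the SUB-WINDOWS `[0,s] ⊆ [0,T]` with one constant `C(T)`; conclusion = `ViscousGlobal ε₀ ν α X₀ X`.
It is a direct application of the Literature theorem
`Literature.Analysis.FluidPDE.TaoCascade.exists_viscousGlobal_of_subcriticalEnvelope_of_inTableClass`
(Duhamel–Picard local theory with `ν`-independent window + continuation under a priori bound +
finitely many dissipation stages `γ ↦ 2γ − 1/2`).

HONEST FRAMING: MODEL lattice ODEs only (Tao 2016 §4); nothing here bears on Navier–Stokes regularity.
This file does NOT close the item as filed; it records the repaired statement with its proof
(`--supports`).
-/

noncomputable section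

set_option linter.dupNamespace false

namespace Summit.NavierStokesRegularity.NavierStokesRegularity.Theorems

namespace SubcriticalEnvelopeEnvelopeSmoothingViscous

open Set Literature.Analysis.FluidPDE Literature.Analysis.FluidPDE.TaoCascade

/-- **ENVELOPE SMOOTHING, viscous family, sub-window-uniform constants** (the repaired form of crux B
`EnvelopeSmoothing`, stmt-NavierStokesRegularity-24008): for every scale ratio `1+ε₀` (`ε₀ > 0`),
margin `η > 0`, spread `R`, table `α ∈ E₂(R)`, one-shell datum `X₀` and viscosity `ν > 0` — if on every
horizon `T > 0` one constant `C` bounds the tail energies `Σ_{k=n}^{N} Σ_i ½X_{i,k}(t)²` of every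
REGULAR solution of the `ν`-viscous lattice from `X₀` on every sub-window `[0,s] ⊆ [0,T]` by
`C(1+ε₀)^{-(1+η)n}`, then the `ν`-viscous lattice has a GLOBAL REGULAR solution from `X₀`.
[cite: BarbatoMorandinRomito2011, §3.2; Tao2016AveragedNS, §4 (viscous equation before Thm. 4.2)] -/
theorem envelopeSmoothing_viscousFamily :
    ∀ (ε₀ η R : ℝ), 0 < ε₀ → 0 < η → ∀ α : Fin 4 → Fin 4 → Fin 4 → ℤ × ℤ × ℤ → ℝ,
      InTableClass R α → ∀ (X₀ : Fin 4 → ℝ) (ν : ℝ), 0 < ν →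
      (∀ T : ℝ, 0 < T → ∃ C : ℝ, ∀ s ∈ Ioc (0 : ℝ) T, ∀ X : Fin 4 → ℤ → ℝ → ℝ,
        (∀ i k, X i k 0 = if k = 0 then X₀ i else 0) →
        (∀ i k, k < 0 → ∀ t, X i k t = 0) →
        (∃ M : ℝ, ∀ (t : ℝ) (i : Fin 4) (k : ℤ), (1 + (1 + ε₀) ^ ((10 : ℝ) * k)) * |X i k t| ≤ M) →
        (∀ i k, Continuous (X i k)) →
        (∀ i k, ∀ t ∈ Icc (0 : ℝ) s, HasDerivWithinAt (X i k)
          (quadTerm ε₀ α X i k t - ν * (1 + ε₀) ^ ((2 : ℝ) * k) * X i k t) (Icc 0 s) t) →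
        ∀ n N : ℕ, n ≤ N → ∀ t ∈ Icc (0 : ℝ) s,
          ∑ k ∈ Finset.Icc n N, ∑ i, (1 / 2) * X i (k : ℤ) t ^ 2 ≤
            C * (1 + ε₀) ^ (-((1 + η) * (n : ℝ)))) →
      ∃ X : Fin 4 → ℤ → ℝ → ℝ, ViscousGlobal ε₀ ν α X₀ X :=
  fun _ε₀ _η _R hε₀ hη _α hα X₀ _ν hν henv =>
    exists_viscousGlobal_of_subcriticalEnvelope_of_inTableClass hε₀.le hη hν hα X₀ henv

end SubcriticalEnvelopeEnvelopeSmoothingViscous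

end Summit.NavierStokesRegularity.NavierStokesRegularity.Theorems

end
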